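import Summits.BirchSwinnertonDyer.BirchSwinnertonDyer.Theorems.BiquadraticEisensteinDescentHeegnerTwistCouplingInSupplySylvesterCornerLucasBridge
import Literature.NumberTheory.EllipticCurves.Rank1Residual.X11RankOneCertificates.Minimality
import HarnessLib

set_option linter.dupNamespace false -- `Summit.BirchSwinnertonDyer.BirchSwinnertonDyer.Theorems.…` (summit = sub, D-0017)
set_option autoImplicit false

/-!
# Crux `HeegnerTwistCouplingInSupply` (stmt-BirchSwinnertonDyer-21381) — the SYLVESTER `j = 0` corner, VI:
# the crux's instance binders DISCHARGED for `W_p = ⟨0, 0, p, 0, 0⟩` — an honest CLOSED statement below `10⁵`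

Route `BiquadraticEisensteinDescent` (cell `pub/bsd-wall`; width seat `bsd-wall-cm-bed-w4` g26; theorems only, `--supports` 21381,
helper). The corner theorems I–V carry the crux's instance binders `[W_p.IsElliptic] [W_p.IsGloballyMinimal] [NeZero (N W_p)]` as
hypotheses. Here they are DISCHARGED for the literal `W_p : y² + p·y = x³` (`p` prime `≠ 3`): `Δ = −27p⁴` has `ord_3 Δ = 3 < 12`,
`ord_p Δ = 4 < 12` (Silverman VII.1 Remark 1.1 at every place via the tree's `isGloballyMinimal_of_int_criterion`), and `N ≠ 0` is the
tree's `conductorNorm_pos_holds`. Result: ★★ `cruxOnSylvesterCorner_closed_lt5` — for EVERY prime `p ≡ 8 (mod 9)` below `10⁵`, modulo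
the `3`-descent hypothesis (card `splitting-bias` L1, UNIT form) and Burungale–Tian ONLY, with no instance hypothesis left: a Heegner
field `K′` of `N(W_p)` with `4 < |d_{K′}|`, `L(W_p^{(d_{K′})}, 1) ≠ 0`, `h(K′) < p`, `p ∤ h(K′)`.

HONEST FRAMING: corner layer on one CM family; the `3`-isogeny descent is NOT formalised (hypothesis); the crux (all CM `W`; residual C⁺)
and BSD are untouched. No definition, no named fact, no `sorry`; axioms standard.
[cite: SilvermanAEC2009, VII.1 Remark 1.1 and VIII.8] [cite: CohenPazuki2009, §2] [cite: BurungaleTian2026, Thm. 1.1]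
-/

noncomputable section

open scoped Classical NumberField

namespace Summit.BirchSwinnertonDyer.BirchSwinnertonDyer.Theorems.SylvesterCorner

open _root_.WeierstrassCurve Literature.NumberTheory.EllipticCurves
open Literature.NumberTheory.EllipticCurves.Rank1Residual.X11RankOneCertificates

/-- **`W_p = ⟨0, 0, p, 0, 0⟩` is a global minimal model** for a prime `p ≠ 3`: the integer model has `Δ = −27p⁴`, and no prime `q`
has `q¹² ∣ Δ` (`q = 3`: `3¹² ∤ 27p⁴`; `q = p`: `p¹² ∤ 27p⁴`; other `q`: `q ∤ Δ`). [cite: SilvermanAEC2009, VII.1 Remark 1.1 and VIII.8] -/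
theorem isGloballyMinimal_sylvester {p : ℕ} (hp : p.Prime) (hp3 : p ≠ 3) :
    (⟨0, 0, (p : ℚ), 0, 0⟩ : WeierstrassCurve ℚ).IsGloballyMinimal := by
  have h := isGloballyMinimal_of_int_criterion 0 0 (p : ℤ) 0 0 ?_
  · simpa only [Int.cast_zero, Int.cast_natCast] using h
  · rintro q hq ⟨h12, -⟩
    have hΔ : discOf [0, 0, (p : ℤ), 0, 0] = -(27 * (p : ℤ) ^ 4) := by
      simp only [discOf, invariants]
      ring
    rw [hΔ, dvd_neg] at h12
    have h12' : q ^ 12 ∣ 27 * p ^ 4 := by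
      have := Int.natAbs_dvd_natAbs.mpr h12
      simpa [Int.natAbs_mul, Int.natAbs_pow] using this
    by_cases hq3 : q = 3
    · subst hq3
      have hcop : Nat.Coprime (3 ^ 12) (p ^ 4) :=
        Nat.Coprime.pow _ _ ((Nat.coprime_primes Nat.prime_three hp).mpr (Ne.symm hp3))
      have h27 : 3 ^ 12 ∣ 27 := hcop.dvd_of_dvd_mul_right h12'
      have := Nat.le_of_dvd (by norm_num) h27
      omega
    · have hcop : Nat.Coprime (q ^ 12) 27 := by
        rw [show (27 : ℕ) = 3 ^ 3 by norm_num]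
        exact Nat.Coprime.pow _ _ ((Nat.coprime_primes hq Nat.prime_three).mpr hq3)
      have hqp : q ^ 12 ∣ p ^ 4 := hcop.dvd_of_dvd_mul_left h12'
      have hq1 : q ∣ p := hq.dvd_of_dvd_pow (dvd_trans (dvd_pow_self q (by norm_num)) hqp)
      have hqeq : q = p := (Nat.prime_dvd_prime_iff_eq hq hp).mp hq1
      subst hqeq
      have := (Nat.pow_dvd_pow_iff_le_right hq.one_lt).mp hqp
      omega

/-- ★★ **The Sylvester corner below `10⁵` — CLOSED form (no instance binders), modulo the unit-form `3`-descent hypothesis and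
Burungale–Tian ONLY.** For every prime `p ≡ 8 (mod 9)` with `p < 10⁵`, `W_p : y² + p·y = x³` is an elliptic curve
(`isElliptic_sylvester`), a global minimal model (`isGloballyMinimal_sylvester`) with `N(W_p) ≠ 0` (`conductorNorm_pos_holds`), and
there is a Heegner field `K′` of `N(W_p)` with `4 < |d_{K′}|`, `L(W_p^{(d_{K′})}, 1) ≠ 0`, `h(K′) < p`, `p ∤ h(K′)` — the conclusion of
`HeegnerTwistCouplingInSupply` at `(W_p, p)`. [cite: CohenPazuki2009, §2] [cite: BurungaleTian2026, Thm. 1.1]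
[cite: SilvermanAEC2009, VII.1 Remark 1.1] -/
theorem cruxOnSylvesterCorner_closed_lt5
    (hDescU : ∀ (p : ℕ) (K : Type) [Field K] [NumberField K], p.Prime → p % 9 = 8 →
      IsImaginaryQuadratic K → 4 < (NumberField.discr K).natAbs →
      jacobiSym (NumberField.discr K) 3 = 1 → jacobiSym (NumberField.discr K) p = 1 →
      ¬ 3 ∣ NumberField.classNumber K →
      (∀ (L : Type) [Field L] [NumberField L], Module.finrank ℚ L = 2 →
        NumberField.discr L = -3 * NumberField.discr K →
        ∃ u : (𝓞 L)ˣ, ∀ x : 𝓞 L, (u : 𝓞 L) - x ^ 3 ∉ Ideal.span {(p : 𝓞 L)}) →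
      ((⟨0, 0, (p : ℚ), 0, 0⟩ : WeierstrassCurve ℚ).quadraticTwist (NumberField.discr K : ℚ)).mordellWeilRank = 0 ∧
      ∀ c ∈ ((⟨0, 0, (p : ℚ), 0, 0⟩ : WeierstrassCurve ℚ).quadraticTwist (NumberField.discr K : ℚ)).sha,
        3 • c = 0 → c = 0)
    (hBT : burungaleTian_analyticRank_eq_zero_of_selmerCorank_eq_zero_of_hasCM) :
    ∀ (p : ℕ) (hp : p.Prime), p % 9 = 8 → p < 100000 →
      haveI := isElliptic_sylvester hp.ne_zero
      ∃ (K : Type) (_ : Field K) (_ : NumberField K),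
        IsImaginaryQuadratic K ∧ 4 < (NumberField.discr K).natAbs ∧
        SatisfiesHeegnerHypothesis ((⟨0, 0, (p : ℚ), 0, 0⟩ : WeierstrassCurve ℚ).conductorNorm ℤ) K ∧
        ((⟨0, 0, (p : ℚ), 0, 0⟩ : WeierstrassCurve ℚ).quadraticTwist (NumberField.discr K : ℚ)).entireLFunction 1 ≠ 0 ∧
        NumberField.classNumber K < p ∧ ¬ p ∣ NumberField.classNumber K := by
  intro p hp hp9 hlt
  haveI : Fact p.Prime := ⟨hp⟩
  haveI := isElliptic_sylvester hp.ne_zero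
  haveI := isGloballyMinimal_sylvester hp (by rintro rfl; omega)
  haveI : NeZero ((⟨0, 0, (p : ℚ), 0, 0⟩ : WeierstrassCurve ℚ).conductorNorm ℤ) :=
    ⟨((⟨0, 0, (p : ℚ), 0, 0⟩ : WeierstrassCurve ℚ).conductorNorm_pos_holds).ne'⟩
  exact cruxOnSylvesterCorner_of_descUnit_BT_lt5 hDescU hBT p hp9 hlt

end Summit.BirchSwinnertonDyer.BirchSwinnertonDyer.Theorems.SylvesterCorner
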